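import Mathlib
import HarnessLib
import Summits.Parity.GeneralizedHardyLittlewood.Theses.LeeYangFibres
import Summits.Parity.GeneralizedHardyLittlewood.Theorems.LeeYangFibresModelHyperbolicity
import Literature.NumberTheory.Sieve.LinearEquationsInPrimesSingularSeries

/-!
# Crux `FibreHyperbolicity` (stmt-Parity-14108), line `SketchIdeator1` (model transfer):
# helpers for the stub `stub_lawOneNorm` — one progression, Green–Tao normalisations at `t = d = 1`

Helper file 1/2 for `stub_lawOneNorm : SegmentLawOne → CellModelLaw 1` (file
`LeeYangFibresFibreHyperbolicityLawOneNorm.lean`). Everything here is about ONE affine-linear form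
`ψ(n) = a n + b` on `ℤ` (`Ψ : Fin 1 → AffLinForm 1`, `a = (Ψ 0).coeff 0`, `b = (Ψ 0).const`):

* `lawOne_eval`, `lawOne_realEval`, `lawOne_size` — `ψ(n) = a n₀ + b`, and `‖Ψ‖_N ≤ L` gives
  `|a| N + |b| ≤ L N`;
* `lawOne_localFactor_eq_zero`, `lawOne_singularProduct_eq_zero`,
  `lawOne_gcd_eq_one_of_singularProduct_pos` — a common prime factor of `a, b` kills `β_p`, hence the
  singular product (the partial products are eventually `0`); so `∏_p β_p > 0 ⇒ gcd(a, b) = 1`;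
* `lawOne_singularProduct_le` — `∏_p β_p ≤ B(L)` (the tree's uniform bound on the partial products,
  `singularProductPartial_le_uniform`, and their convergence `tendsto_singularProductPartial_holds`;
  finite complexity is vacuous for one form);
* `lawOne_core` — THE DICTIONARY: for `a ≥ 1`, `gcd(a, b) = 1` and consecutive integers
  `n₁ ≤ … ≤ n₂` with `a n₁ + b ≥ 1`, the map `n ↦ a n + b` is a bijection onto the class
  `b mod a` of the segment `(M₁, M₂]`, `M₂ = a n₂ + b`, `M₁ = (a (n₁ - 1) + b)⁺`, so the segment law
  (hypothesis of the stub, at scale `N`) yields the cell law for the `Ω`-cells of the rough values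
  `a n + b`, `n₁ ≤ n ≤ n₂`, with `Λ = (M₂ − M₁)/(φ(a) log N)`;
* `lawOne_oneDim` — the same for the integer points of a bounded order-connected set `J ⊆ [-N, N]`
  on which `a y + b > 0`: they are consecutive, and there are at least `vol(J) − 1` of them.
-/

noncomputable section

namespace Summit.Parity.GeneralizedHardyLittlewood.Cruxes.FibreHyperbolicity.ModelTransfer

open scoped BigOperators Classical
open Finset Polynomial Filter MeasureTheory
open scoped Topology
open Literature.NumberTheory.Sieve
open Summit.Parity.GeneralizedHardyLittlewood.Cruxes.ModelHyperbolicity.WindowChainTransport (cellDensity)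

/-! ### One form on `ℤ`: values and size -/

/-- `ψ_k(n) = a n₀ + b` for the (only) form of a system of one form on `ℤ`. -/
theorem lawOne_eval (Ψ : Fin 1 → AffLinForm 1) (k : Fin 1) (n : Fin 1 → ℤ) :
    (Ψ k).eval n = (Ψ 0).coeff 0 * n 0 + (Ψ 0).const := by
  rw [Fin.fin_one_eq_zero k, AffLinForm.eval, Fin.sum_univ_one]

/-- `ψ_k(x) = a x₀ + b` for the real extension. -/
theorem lawOne_realEval (Ψ : Fin 1 → AffLinForm 1) (k : Fin 1) (x : Fin 1 → ℝ) :
    (Ψ k).realEval x = ((Ψ 0).coeff 0 : ℝ) * x 0 + (Ψ 0).const := by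
  rw [Fin.fin_one_eq_zero k, AffLinForm.realEval, Fin.sum_univ_one]

/-- `‖Ψ‖_N ≤ L` for one form `a n + b` reads `|a| + |b|/N ≤ L`, i.e. `|a| N + |b| ≤ L N`. -/
theorem lawOne_size {Ψ : Fin 1 → AffLinForm 1} {N : ℕ} {L : ℝ} (hN : 0 < N)
    (h : affLinSize Ψ N ≤ L) :
    |((Ψ 0).coeff 0 : ℝ)| * N + |((Ψ 0).const : ℝ)| ≤ L * N := by
  have hN' : (0 : ℝ) < N := by exact_mod_cast hN
  rw [affLinSize, Fin.sum_univ_one, Fin.sum_univ_one, Fin.sum_univ_one, abs_div,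
    abs_of_pos hN'] at h
  have := mul_le_mul_of_nonneg_right h hN'.le
  rwa [add_mul, div_mul_cancel₀ _ hN'.ne'] at this

/-! ### The singular product of one form -/

/-- A prime dividing both `a` and `b` kills the local factor: `β_p = p⁻¹ ∑_{n mod p} Λ_p(a n + b) = 0`. -/
theorem lawOne_localFactor_eq_zero (Ψ : Fin 1 → AffLinForm 1) {p : ℕ} (hp : p.Prime)
    (hpa : (p : ℤ) ∣ (Ψ 0).coeff 0) (hpb : (p : ℤ) ∣ (Ψ 0).const) : localFactor Ψ p = 0 := by
  unfold localFactor
  rw [Finset.sum_eq_zero, mul_zero]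
  intro n _
  rw [Fin.prod_univ_one, lawOne_eval]
  unfold localVonMangoldt
  rw [if_neg]
  intro h
  have hdvd : (p : ℤ) ∣ (Ψ 0).coeff 0 * ((n 0 : ℕ) : ℤ) + (Ψ 0).const := (hpa.mul_right _).add hpb
  have h1 : p ∣ Int.gcd ((Ψ 0).coeff 0 * ((n 0 : ℕ) : ℤ) + (Ψ 0).const) p := Int.dvd_gcd hdvd dvd_rfl
  rw [h] at h1
  exact hp.ne_one (Nat.dvd_one.mp h1)

/-- Hence the singular product vanishes: the partial products `∏_{p' ≤ x} β_{p'}` are `0` for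
`x ≥ p`, and the ordered limit of an eventually constant sequence is that constant. -/
theorem lawOne_singularProduct_eq_zero (Ψ : Fin 1 → AffLinForm 1) {p : ℕ} (hp : p.Prime)
    (hpa : (p : ℤ) ∣ (Ψ 0).coeff 0) (hpb : (p : ℤ) ∣ (Ψ 0).const) : singularProduct Ψ = 0 := by
  have hev : ∀ x, p ≤ x → singularProductPartial Ψ x = 0 := fun x hx =>
    Finset.prod_eq_zero (Nat.mem_primesLE.mpr ⟨hx, hp⟩) (lawOne_localFactor_eq_zero Ψ hp hpa hpb)
  have ht : Tendsto (singularProductPartial Ψ) atTop (𝓝 0) :=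
    tendsto_const_nhds.congr'
      (Filter.eventuallyEq_of_mem (Filter.Ici_mem_atTop p) fun x hx => (hev x hx).symm)
  unfold singularProduct
  exact ht.limUnder_eq

/-- `∏_p β_p > 0` forces `gcd(a, b) = 1` (no local obstruction). -/
theorem lawOne_gcd_eq_one_of_singularProduct_pos (Ψ : Fin 1 → AffLinForm 1)
    (h : 0 < singularProduct Ψ) : Int.gcd ((Ψ 0).coeff 0) ((Ψ 0).const) = 1 := by
  by_contra hne
  have hp := Nat.minFac_prime hne
  have hpg : ((Int.gcd ((Ψ 0).coeff 0) ((Ψ 0).const)).minFac : ℤ) ∣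
      (Int.gcd ((Ψ 0).coeff 0) ((Ψ 0).const) : ℤ) :=
    Int.natCast_dvd_natCast.mpr (Nat.minFac_dvd _)
  have h0 := lawOne_singularProduct_eq_zero Ψ hp (hpg.trans (Int.gcd_dvd_left _ _))
    (hpg.trans (Int.gcd_dvd_right _ _))
  linarith

/-- `∏_p β_p ≤ B(L)` for every non-degenerate system of one form on `ℤ` with `|a| ≤ L`
(uniform bound on the partial products, which converge; one form has finite complexity). -/
theorem lawOne_singularProduct_le : ∀ L : ℕ, ∃ B : ℝ, 1 ≤ B ∧ ∀ Ψ : Fin 1 → AffLinForm 1,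
    IsNondegenerateSystem Ψ → (∀ i j, ((Ψ i).coeff j).natAbs ≤ L) → singularProduct Ψ ≤ B := by
  intro L
  obtain ⟨B, -, hB⟩ := singularProductPartial_le_uniform 1 L
  refine ⟨max B 1, le_max_right _ _, fun Ψ hΨ hL => ?_⟩
  have hfc : IsFiniteComplexitySystem Ψ := fun i j hij => absurd (Subsingleton.elim i j) hij
  have hT := tendsto_singularProductPartial_holds 1 1 Ψ hΨ
  exact (le_of_tendsto' hT fun w => (hB 1 Ψ hΨ hfc hL w).2).trans (le_max_left _ _)

/-! ### The dictionary: rough values of `a n + b` on consecutive integers = a class in a segment -/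

/-- The class `b mod a` as a natural residue: for `a ≥ 1`, `q = a`, `r = b mod a` (as naturals),
`m ≡ r (mod q)` iff `m mod a = b mod a` in `ℤ`. -/
-- adapted from `Literature.NumberTheory.Sieve.LinearRoughValues.modEq_toNat_iff`
theorem lawOne_modEq_iff {a b : ℤ} {q r : ℕ} (ha : 0 < a) (hq : (q : ℤ) = a) (hr : (r : ℤ) = b % a)
    (m : ℕ) : m ≡ r [MOD q] ↔ (m : ℤ) % a = b % a := by
  have hrq : r < q := by
    have : b % a < a := Int.emod_lt_of_pos b ha
    omega
  rw [Nat.ModEq, Nat.mod_eq_of_lt hrq]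
  constructor
  · intro h
    have h' := congrArg (Nat.cast : ℕ → ℤ) h
    rwa [Int.natCast_mod, hq, hr] at h'
  · intro h
    have h' : ((m % q : ℕ) : ℤ) = (r : ℤ) := by rw [Int.natCast_mod, hq, hr, h]
    exact_mod_cast h'

/-- **The dictionary.** For `a ≥ 1` and integers `n₁ ≤ n` with `a n₁ + b ≥ 1`, the map `n ↦ a n + b`
is a bijection from `{n₁ ≤ n ≤ n₂ : P(a n + b)}` onto `{m ∈ (M₁, M₂] : m ≡ r (q), P(m)}`, where
`q = a`, `r = b mod a`, `M₂ = a n₂ + b`, `M₁ = (a (n₁ - 1) + b)⁺` (inverse `m ↦ (m - b)/a`); here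
`P(m)` is "`m` is `N^{1/u}`-rough with `Ω(m) = j`". -/
theorem lawOne_card_bij (N u j : ℕ) {a b n₁ n₂ : ℤ} {q r M₁ M₂ : ℕ} (ha : 0 < a)
    (hq : (q : ℤ) = a) (hr : (r : ℤ) = b % a) (hM₁ : (M₁ : ℤ) = max (a * (n₁ - 1) + b) 0)
    (hM₂ : (M₂ : ℤ) = a * n₂ + b) (hn₁ : 1 ≤ a * n₁ + b) :
    ((Finset.Icc n₁ n₂).filter (fun n =>
        (N : ℝ) ^ ((1 : ℝ) / u) < (Nat.minFac (a * n + b).toNat : ℝ) ∧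
          ArithmeticFunction.cardFactors (a * n + b).toNat = j)).card =
      ((Finset.Ioc M₁ M₂).filter (fun m => m ≡ r [MOD q] ∧
        (N : ℝ) ^ ((1 : ℝ) / u) < (Nat.minFac m : ℝ) ∧
          ArithmeticFunction.cardFactors m = j)).card := by
  refine Finset.card_nbij' (fun n => (a * n + b).toNat) (fun m => ((m : ℤ) - b) / a)
    ?_ ?_ ?_ ?_
  · intro n hn
    rw [Finset.mem_coe, Finset.mem_filter, Finset.mem_Icc] at hn
    obtain ⟨⟨h1n, hn2⟩, hP⟩ := hn
    have h1 : a * n₁ ≤ a * n := mul_le_mul_of_nonneg_left h1n ha.le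
    have h2 : a * n ≤ a * n₂ := mul_le_mul_of_nonneg_left hn2 ha.le
    have h3 : a * (n₁ - 1) < a * n := mul_lt_mul_of_pos_left (by omega) ha
    have hmZ : (((a * n + b).toNat : ℕ) : ℤ) = a * n + b := Int.toNat_of_nonneg (by omega)
    rw [Finset.mem_coe, Finset.mem_filter, Finset.mem_Ioc]
    refine ⟨⟨?_, ?_⟩, ?_, hP⟩
    · have : (M₁ : ℤ) < ((a * n + b).toNat : ℕ) := by
        rw [hM₁, hmZ]
        exact max_lt (by omega) (by omega)
      exact_mod_cast this
    · have : (((a * n + b).toNat : ℕ) : ℤ) ≤ M₂ := by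
        rw [hM₂, hmZ]
        omega
      exact_mod_cast this
    · rw [lawOne_modEq_iff ha hq hr, hmZ, add_comm, Int.add_mul_emod_self_left]
  · intro m hm
    rw [Finset.mem_coe, Finset.mem_filter, Finset.mem_Ioc, lawOne_modEq_iff ha hq hr] at hm
    obtain ⟨⟨h1m, hm2⟩, hcl, hP⟩ := hm
    have hdvd : a ∣ (m : ℤ) - b := (Int.ModEq.symm hcl).dvd
    have hk : a * (((m : ℤ) - b) / a) = m - b := Int.mul_ediv_cancel' hdvd
    have h1 : (M₁ : ℤ) < m := by exact_mod_cast h1m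
    have h2 : (m : ℤ) ≤ M₂ := by exact_mod_cast hm2
    rw [hM₁] at h1
    rw [hM₂] at h2
    rw [Finset.mem_coe, Finset.mem_filter, Finset.mem_Icc]
    refine ⟨⟨?_, ?_⟩, ?_⟩
    · by_contra hlt
      have hlt' : ((m : ℤ) - b) / a < n₁ := not_le.mp hlt
      have h4 : a * (((m : ℤ) - b) / a) ≤ a * (n₁ - 1) :=
        mul_le_mul_of_nonneg_left (by omega) ha.le
      rw [hk] at h4
      have h5 : a * (n₁ - 1) + b < m := lt_of_le_of_lt (le_max_left _ _) h1
      omega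
    · have h3 : a * (((m : ℤ) - b) / a) ≤ a * n₂ := by
        rw [hk]
        omega
      exact le_of_mul_le_mul_left h3 ha
    · rw [hk, sub_add_cancel, Int.toNat_natCast]
      exact hP
  · intro n hn
    rw [Finset.mem_coe, Finset.mem_filter, Finset.mem_Icc] at hn
    have h1 : a * n₁ ≤ a * n := mul_le_mul_of_nonneg_left hn.1.1 ha.le
    have hpos : 0 ≤ a * n + b := by omega
    simp only [Int.toNat_of_nonneg hpos, add_sub_cancel_right, Int.mul_ediv_cancel_left _ ha.ne']
  · intro m hm
    rw [Finset.mem_coe, Finset.mem_filter, lawOne_modEq_iff ha hq hr] at hm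
    have hdvd : a ∣ (m : ℤ) - b := (Int.ModEq.symm hm.2.1).dvd
    simp only [Int.mul_ediv_cancel' hdvd, sub_add_cancel, Int.toNat_natCast]

/-- **The dictionary plus the segment law.** Let `1 ≤ a ≤ L`, `gcd(a, b) = 1`, and let `n₁ ≤ n₂`
be integers with `a n₁ + b ≥ 1`, `a n₂ + b ≤ L N` and `n₂ - n₁ + 1 ≥ η' N`. With `q, r, M₁, M₂` as
in `lawOne_card_bij`, `r` is prime to `q ≤ L`, `M₂ ≤ L N` and `M₂ - M₁ ≥ n₂ - n₁ + 1 ≥ η' N`; so the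
segment law at scale `N ≥ 2` (the hypothesis `hH`) is the cell law for the `Ω`-cells of the
`N^{1/u}`-rough values `a n + b`, `n₁ ≤ n ≤ n₂`, with `Λ = (M₂ - M₁)/(φ(q) log N) > 0`. -/
theorem lawOne_core {N u L : ℕ} {ε η' : ℝ} (hN : 2 ≤ N)
    (hH : ∀ q r : ℕ, 1 ≤ q → q ≤ L → r.Coprime q → ∀ M₁ M₂ : ℕ, M₁ ≤ M₂ → (M₂ : ℝ) ≤ L * N →
      η' * N ≤ (M₂ : ℝ) - M₁ → ∀ j : ℕ, 1 ≤ j → j ≤ u →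
        |((((Finset.Ioc M₁ M₂).filter (fun m => m ≡ r [MOD q] ∧
              (N : ℝ) ^ ((1 : ℝ) / u) < (Nat.minFac m : ℝ) ∧
                ArithmeticFunction.cardFactors m = j)).card : ℕ) : ℝ) -
            ((M₂ : ℝ) - M₁) / ((Nat.totient q : ℝ) * Real.log N) * cellDensity (j - 1) u| ≤
          ε * (((M₂ : ℝ) - M₁) / ((Nat.totient q : ℝ) * Real.log N)) *
            (if j < u then cellDensity (j - 1) u else 1))
    {a b : ℤ} (ha : 0 < a) (haL : a ≤ L) (hab : Int.gcd a b = 1) {n₁ n₂ : ℤ} (h12 : n₁ ≤ n₂)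
    (hn₁ : 1 ≤ a * n₁ + b) (hn₂ : ((a * n₂ + b : ℤ) : ℝ) ≤ L * N)
    (hlen : η' * N ≤ ((n₂ + 1 - n₁ : ℤ) : ℝ)) :
    ∃ Λ : ℝ, 0 < Λ ∧ ∀ j ∈ Finset.Icc 1 u,
      |((((Finset.Icc n₁ n₂).filter (fun n =>
            (N : ℝ) ^ ((1 : ℝ) / u) < (Nat.minFac (a * n + b).toNat : ℝ) ∧
              ArithmeticFunction.cardFactors (a * n + b).toNat = j)).card : ℕ) : ℝ) -
          Λ * cellDensity (j - 1) u| ≤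
        ε * Λ * (if j < u then cellDensity (j - 1) u else 1) := by
  -- the modulus, the class, the segment
  have h1 : a * n₁ ≤ a * n₂ := mul_le_mul_of_nonneg_left h12 ha.le
  obtain ⟨q, hq⟩ : ∃ q : ℕ, (q : ℤ) = a := ⟨a.toNat, Int.toNat_of_nonneg ha.le⟩
  obtain ⟨r, hr⟩ : ∃ r : ℕ, (r : ℤ) = b % a :=
    ⟨(b % a).toNat, Int.toNat_of_nonneg (Int.emod_nonneg b ha.ne')⟩
  obtain ⟨M₂, hM₂⟩ : ∃ M₂ : ℕ, (M₂ : ℤ) = a * n₂ + b :=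
    ⟨(a * n₂ + b).toNat, Int.toNat_of_nonneg (by omega)⟩
  obtain ⟨M₁, hM₁⟩ : ∃ M₁ : ℕ, (M₁ : ℤ) = max (a * (n₁ - 1) + b) 0 :=
    ⟨(a * (n₁ - 1) + b).toNat, Int.toNat_eq_max _⟩
  have h1q : 1 ≤ q := by omega
  have hqL : q ≤ L := by omega
  have hrq : r.Coprime q := by
    rw [Nat.coprime_iff_gcd_eq_one, ← Int.gcd_natCast_natCast, hr, hq, Int.gcd_emod,
      Int.gcd_comm, hab]
  have hdiff : n₂ + 1 - n₁ ≤ (M₂ : ℤ) - M₁ ∧ (M₁ : ℤ) ≤ M₂ := by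
    rw [hM₁, hM₂]
    rcases le_or_gt 0 (a * (n₁ - 1) + b) with h | h
    · rw [max_eq_left h]
      have e : a * n₂ + b - (a * (n₁ - 1) + b) - (n₂ + 1 - n₁) = (a - 1) * (n₂ + 1 - n₁) := by
        ring
      have := mul_nonneg (sub_nonneg.mpr (show (1 : ℤ) ≤ a from ha))
        (show (0 : ℤ) ≤ n₂ + 1 - n₁ by omega)
      constructor <;> linarith
    · rw [max_eq_right h.le]
      have e : a * n₂ + b - (n₂ - n₁) - (a * n₁ + b) = (a - 1) * (n₂ - n₁) := by ring
      have := mul_nonneg (sub_nonneg.mpr (show (1 : ℤ) ≤ a from ha)) (sub_nonneg.mpr h12)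
      constructor <;> linarith
  have hM12 : M₁ ≤ M₂ := by exact_mod_cast hdiff.2
  have hM₂R : ((M₂ : ℕ) : ℝ) ≤ L * N := by
    have : ((M₂ : ℕ) : ℝ) = ((a * n₂ + b : ℤ) : ℝ) := by exact_mod_cast hM₂
    rw [this]
    exact hn₂
  have hdiffR : ((n₂ + 1 - n₁ : ℤ) : ℝ) ≤ (M₂ : ℝ) - M₁ := by exact_mod_cast hdiff.1
  have hlen' : η' * N ≤ (M₂ : ℝ) - M₁ := hlen.trans hdiffR
  -- the normaliser
  have hφ : (0 : ℝ) < (Nat.totient q : ℝ) := by exact_mod_cast Nat.totient_pos.mpr (by omega)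
  have hlog : 0 < Real.log N := Real.log_pos (by exact_mod_cast hN)
  have hnum : (0 : ℝ) < (M₂ : ℝ) - M₁ := by
    have : (1 : ℝ) ≤ ((n₂ + 1 - n₁ : ℤ) : ℝ) := by
      exact_mod_cast (show (1 : ℤ) ≤ n₂ + 1 - n₁ by omega)
    linarith
  refine ⟨((M₂ : ℝ) - M₁) / ((Nat.totient q : ℝ) * Real.log N), div_pos hnum (mul_pos hφ hlog),
    fun j hj => ?_⟩
  rw [Finset.mem_Icc] at hj
  rw [lawOne_card_bij N u j ha hq hr hM₁ hM₂ hn₁]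
  exact hH q r h1q hqL hrq M₁ M₂ hM12 hM₂R hlen' j hj.1 hj.2

/-! ### Integer points of an order-connected window -/

/-- **From a window to consecutive integers.** Let `1 ≤ a ≤ L`, `gcd(a, b) = 1`, `a N + |b| ≤ L N`,
and let `J ⊆ [-N, N]` be order-connected with `a y + b > 0` on `J` and `vol(J) ≥ η' N + 1`. The
integer points of `J` are consecutive, `n₁ ≤ … ≤ n₂` (order-connectedness), and there are at least
`vol(J) - 1 ≥ η' N` of them (`J ⊆ [inf J, sup J]` while every integer of `(inf J, sup J)` lies in
`J`); `a n₁ + b ≥ 1` and `a n₂ + b ≤ a N + |b| ≤ L N`. So `lawOne_core` applies: the `Ω`-cells of the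
`N^{1/u}`-rough values `a n + b`, `n ∈ J ∩ ℤ`, obey the cell law. -/
theorem lawOne_oneDim {N u L : ℕ} {ε η' : ℝ} (hN : 2 ≤ N) (hη' : 0 < η')
    (hH : ∀ q r : ℕ, 1 ≤ q → q ≤ L → r.Coprime q → ∀ M₁ M₂ : ℕ, M₁ ≤ M₂ → (M₂ : ℝ) ≤ L * N →
      η' * N ≤ (M₂ : ℝ) - M₁ → ∀ j : ℕ, 1 ≤ j → j ≤ u →
        |((((Finset.Ioc M₁ M₂).filter (fun m => m ≡ r [MOD q] ∧
              (N : ℝ) ^ ((1 : ℝ) / u) < (Nat.minFac m : ℝ) ∧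
                ArithmeticFunction.cardFactors m = j)).card : ℕ) : ℝ) -
            ((M₂ : ℝ) - M₁) / ((Nat.totient q : ℝ) * Real.log N) * cellDensity (j - 1) u| ≤
          ε * (((M₂ : ℝ) - M₁) / ((Nat.totient q : ℝ) * Real.log N)) *
            (if j < u then cellDensity (j - 1) u else 1))
    {a b : ℤ} (ha : 0 < a) (haL : a ≤ L) (hab : Int.gcd a b = 1)
    (habN : (a : ℝ) * N + |(b : ℝ)| ≤ L * N)
    {J : Set ℝ} (hJ : J.OrdConnected) (hJN : J ⊆ Set.Icc (-(N : ℝ)) N)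
    (hJpos : ∀ y ∈ J, 0 < (a : ℝ) * y + b) (hvol : η' * N + 1 ≤ (volume J).toReal) :
    ∃ Λ : ℝ, 0 < Λ ∧ ∀ j ∈ Finset.Icc 1 u,
      |((((Finset.Icc (-(N : ℤ)) N).filter (fun n : ℤ => (n : ℝ) ∈ J ∧
            ((N : ℝ) ^ ((1 : ℝ) / u) < (Nat.minFac (a * n + b).toNat : ℝ) ∧
              ArithmeticFunction.cardFactors (a * n + b).toNat = j))).card : ℕ) : ℝ) -
          Λ * cellDensity (j - 1) u| ≤
        ε * Λ * (if j < u then cellDensity (j - 1) u else 1) := by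
  -- the integer points of `J`
  set T := (Finset.Icc (-(N : ℤ)) N).filter (fun n : ℤ => (n : ℝ) ∈ J) with hT
  have hmemT : ∀ {n : ℤ}, n ∈ T ↔ n ∈ Finset.Icc (-(N : ℤ)) N ∧ (n : ℝ) ∈ J := Finset.mem_filter
  have hmemT' : ∀ {n : ℤ}, (n : ℝ) ∈ J → n ∈ T := fun {n} hn => by
    have h := hJN hn
    rw [Set.mem_Icc] at h
    exact hmemT.mpr ⟨Finset.mem_Icc.mpr ⟨by exact_mod_cast h.1, by exact_mod_cast h.2⟩, hn⟩
  -- there are at least `vol(J) - 1` of them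
  have hTcard : (volume J).toReal ≤ (T.card : ℝ) + 1 := by
    rcases J.eq_empty_or_nonempty with hJe | hJne
    · rw [hJe, measure_empty, ENNReal.toReal_zero]
      positivity
    · have hbb : BddBelow J := ⟨-(N : ℝ), fun y hy => (hJN hy).1⟩
      have hba : BddAbove J := ⟨N, fun y hy => (hJN hy).2⟩
      have hvol' : (volume J).toReal ≤ sSup J - sInf J := by
        have h1 : volume J ≤ ENNReal.ofReal (sSup J - sInf J) :=
          (measure_mono (subset_Icc_csInf_csSup hbb hba)).trans_eq Real.volume_Icc
        have h2 : 0 ≤ sSup J - sInf J := sub_nonneg.mpr (csInf_le_csSup hJne hbb hba)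
        calc (volume J).toReal ≤ (ENNReal.ofReal (sSup J - sInf J)).toReal :=
              ENNReal.toReal_mono ENNReal.ofReal_ne_top h1
          _ = sSup J - sInf J := ENNReal.toReal_ofReal h2
      have hIoo : Finset.Ioo ⌊sInf J⌋ ⌈sSup J⌉ ⊆ T := by
        intro n hn
        rw [Finset.mem_Ioo, Int.floor_lt, Int.lt_ceil] at hn
        obtain ⟨y₁, hy₁, hy₁n⟩ := exists_lt_of_csInf_lt hJne hn.1
        obtain ⟨y₂, hy₂, hny₂⟩ := exists_lt_of_lt_csSup hJne hn.2
        exact hmemT' (hJ.out hy₁ hy₂ ⟨hy₁n.le, hny₂.le⟩)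
      have h3 : ((Finset.Ioo ⌊sInf J⌋ ⌈sSup J⌉).card : ℝ) ≤ T.card := by
        exact_mod_cast Finset.card_le_card hIoo
      have h4 : (⌈sSup J⌉ : ℝ) - ⌊sInf J⌋ - 1 ≤ ((Finset.Ioo ⌊sInf J⌋ ⌈sSup J⌉).card : ℝ) := by
        have : (⌈sSup J⌉ - ⌊sInf J⌋ - 1 : ℤ) ≤ ((Finset.Ioo ⌊sInf J⌋ ⌈sSup J⌉).card : ℤ) := by
          rw [Int.card_Ioo]
          exact Int.self_le_toNat _
        exact_mod_cast this
      have h5 := Int.floor_le (sInf J)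
      have h6 := Int.le_ceil (sSup J)
      linarith
  -- hence `T` is non-empty; its extreme points `n₁ ≤ n₂`
  have hN0 : (0 : ℝ) < N := by exact_mod_cast (show 0 < N by omega)
  have hTpos : (0 : ℝ) < T.card := by linarith [mul_pos hη' hN0]
  have hTne : T.Nonempty := by
    rw [← Finset.card_pos]
    exact_mod_cast hTpos
  obtain ⟨n₁, hn₁T, hn₁min⟩ : ∃ n₁ ∈ T, ∀ m ∈ T, n₁ ≤ m :=
    ⟨T.min' hTne, T.min'_mem hTne, fun m hm => T.min'_le m hm⟩
  obtain ⟨n₂, hn₂T, hn₂max⟩ : ∃ n₂ ∈ T, ∀ m ∈ T, m ≤ n₂ :=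
    ⟨T.max' hTne, T.max'_mem hTne, fun m hm => T.le_max' m hm⟩
  have hn₁J : (n₁ : ℝ) ∈ J := (hmemT.mp hn₁T).2
  have hn₂J : (n₂ : ℝ) ∈ J := (hmemT.mp hn₂T).2
  have h12 : n₁ ≤ n₂ := hn₁min n₂ hn₂T
  -- `T = {n₁, …, n₂}` by order-connectedness
  have hTeq : ∀ m : ℤ, m ∈ T ↔ m ∈ Finset.Icc n₁ n₂ := fun m => by
    rw [Finset.mem_Icc]
    constructor
    · exact fun hm => ⟨hn₁min m hm, hn₂max m hm⟩
    · rintro ⟨h1, h2⟩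
      exact hmemT' (hJ.out hn₁J hn₂J ⟨by exact_mod_cast h1, by exact_mod_cast h2⟩)
  have hTeq' : T = Finset.Icc n₁ n₂ := Finset.ext hTeq
  have hTcard' : (T.card : ℝ) = ((n₂ + 1 - n₁ : ℤ) : ℝ) := by
    rw [hTeq', Int.card_Icc]
    have : (((n₂ + 1 - n₁).toNat : ℕ) : ℤ) = n₂ + 1 - n₁ := Int.toNat_of_nonneg (by omega)
    exact_mod_cast this
  have hlen : η' * N ≤ ((n₂ + 1 - n₁ : ℤ) : ℝ) := by
    rw [← hTcard']
    linarith
  -- the endpoint values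
  have hn₁ : 1 ≤ a * n₁ + b := by
    have h := hJpos _ hn₁J
    have : (0 : ℤ) < a * n₁ + b := by exact_mod_cast h
    omega
  have hn₂ : ((a * n₂ + b : ℤ) : ℝ) ≤ L * N := by
    have h2N : (n₂ : ℝ) ≤ N := (hJN hn₂J).2
    have ha' : (0 : ℝ) ≤ a := by exact_mod_cast ha.le
    have := mul_le_mul_of_nonneg_left h2N ha'
    push_cast
    linarith [le_abs_self (b : ℝ)]
  obtain ⟨Λ, hΛ, hmain⟩ := lawOne_core hN hH ha haL hab h12 hn₁ hn₂ hlen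
  refine ⟨Λ, hΛ, fun j hj => ?_⟩
  have hc : ((Finset.Icc (-(N : ℤ)) N).filter (fun n : ℤ => (n : ℝ) ∈ J ∧
        ((N : ℝ) ^ ((1 : ℝ) / u) < (Nat.minFac (a * n + b).toNat : ℝ) ∧
          ArithmeticFunction.cardFactors (a * n + b).toNat = j))) =
      (Finset.Icc n₁ n₂).filter (fun n =>
        (N : ℝ) ^ ((1 : ℝ) / u) < (Nat.minFac (a * n + b).toNat : ℝ) ∧
          ArithmeticFunction.cardFactors (a * n + b).toNat = j) := by
    ext m
    rw [Finset.mem_filter, Finset.mem_filter, ← hTeq m, hmemT, and_assoc]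
  rw [hc]
  exact hmain j hj

end Summit.Parity.GeneralizedHardyLittlewood.Cruxes.FibreHyperbolicity.ModelTransfer

end
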